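import Summits.KontsevichZagierPeriods.KontsevichZagierPeriods.Theorems.RootDecompWalshStrataCutBall4WideBase

/-!
# Root decomposition on Walsh strata — part 111 (gen 13, addendum 1): the wide cap chart

Crux `QuadricSignKernel` (item 25393), slice `d = 4`; notation of parts 104–110.  The chart
`Φ♯(y, y₁, u₀, u₁) = (1 + y, 2y₁, s·u₀, s·u₁)`, `s = √(ρ − (1+y)² − 4y₁²)`, carries the source
`srcRepH ρ q = tRepH ρ q × [unit quarter disc, 1]` (part 110) onto the cap `[K_0(ρ), q]` for every
`ρ ≤ 4`: lower block-triangular Jacobian with `det Φ♯' = 2s²`, matching the source weight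
`8q·g♯ = 2q·s²`.  Main statement: `of_srcRepH_sub_of_capRepW_mem_relations` —
`[srcRepH ρ q] − [K_0(ρ), q] ∈ KZ.relations` (Kontsevich–Zagier's rule (2)); the proof is the one
of part 105 with the second base coordinate doubled.
[KontsevichZagier2001 §1.2 rule (2), §4.1; BCR1998 §2.2]
-/

noncomputable section

open Literature.NumberTheory.Transcendental
open MeasureTheory Set
open MvPolynomial (aeval X C)
open Literature.ModelTheory.ExponentialFields (IsSemialgebraic)
open Summit.KontsevichZagierPeriods.RootDecompWalshStrata.WalshSpanProof (cellRep cellRep_domain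
  cellRep_integrand)
open Summit.KontsevichZagierPeriods.RootDecompWalshStrata.ConeSpecimen (discPoly aeval_discPoly)

namespace Summit.KontsevichZagierPeriods.RootDecompWalshStrata.CutBall4

variable {ρ : ℚ}

/-! #### The chart `Φ♯(y, y₁, u₀, u₁) = (1 + y, 2y₁, s·u₀, s·u₁)` -/

/-- The fibre radius squared of the cap, read in the rescaled source coordinates. -/
def gW (ρ : ℚ) (z : Fin 4 → ℝ) : ℝ := (ρ : ℝ) - (1 + z 0) ^ 2 - 4 * z 1 ^ 2

/-- The fibre radius `s = √g`. -/
def sW (ρ : ℚ) (z : Fin 4 → ℝ) : ℝ := √(gW ρ z)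

/-- `s² = g` where `g ≥ 0`. [folklore] -/
theorem sW_sq {z : Fin 4 → ℝ} (hz : 0 ≤ gW ρ z) : sW ρ z ^ 2 = gW ρ z := Real.sq_sqrt hz

/-- `s > 0` where `g > 0`. [folklore] -/
theorem sW_pos {z : Fin 4 → ℝ} (hz : 0 < gW ρ z) : 0 < sW ρ z := Real.sqrt_pos.2 hz

/-- The wide cap chart. -/
def phiW (ρ : ℚ) (z : Fin 4 → ℝ) : Fin 4 → ℝ := ![1 + z 0, 2 * z 1, sW ρ z * z 2, sW ρ z * z 3]

/-- Component `0` of the chart: `x₀ = 1 + y`. [definition] -/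
@[simp] theorem phiW_zero (z : Fin 4 → ℝ) : phiW ρ z 0 = 1 + z 0 := rfl

/-- Component `1` of the chart: `x₁ = 2y₁`. [definition] -/
@[simp] theorem phiW_one (z : Fin 4 → ℝ) : phiW ρ z 1 = 2 * z 1 := rfl

/-- Component `2` of the chart: `x₂ = s·u₀`. [definition] -/
@[simp] theorem phiW_two (z : Fin 4 → ℝ) : phiW ρ z 2 = sW ρ z * z 2 := rfl

/-- Component `3` of the chart: `x₃ = s·u₁`. [definition] -/
@[simp] theorem phiW_three (z : Fin 4 → ℝ) : phiW ρ z 3 = sW ρ z * z 3 := rfl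

/-- The Jacobian matrix of `Φ♯` (lower block-triangular; `∂s/∂y = −(1+y)/s`, `∂s/∂y₁ = −4y₁/s`). -/
def phiWMat (ρ : ℚ) (z : Fin 4 → ℝ) : Matrix (Fin 4) (Fin 4) ℝ :=
  !![1, 0, 0, 0;
     0, 2, 0, 0;
     -(1 + z 0) / sW ρ z * z 2, -(4 * z 1) / sW ρ z * z 2, sW ρ z, 0;
     -(1 + z 0) / sW ρ z * z 3, -(4 * z 1) / sW ρ z * z 3, 0, sW ρ z]

/-- The derivative of `Φ♯` as a continuous linear map. -/
def phiW' (ρ : ℚ) (z : Fin 4 → ℝ) : (Fin 4 → ℝ) →L[ℝ] (Fin 4 → ℝ) :=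
  LinearMap.toContinuousLinearMap (Matrix.toLin' (phiWMat ρ z))

/-- `Φ♯'(z)` acts by the Jacobian matrix. [calculus] -/
theorem phiW'_apply (z v : Fin 4 → ℝ) (a : Fin 4) : phiW' ρ z v a = ∑ b, phiWMat ρ z a b * v b := by
  change Matrix.toLin' (phiWMat ρ z) v a = _
  rw [Matrix.toLin'_apply]
  rfl

/-- `det Φ♯'(z) = 2s²`. [calculus] -/
theorem phiW'_det (z : Fin 4 → ℝ) : (phiW' ρ z).det = 2 * sW ρ z ^ 2 := by
  change LinearMap.det (Matrix.toLin' (phiWMat ρ z)) = _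
  rw [LinearMap.det_toLin', phiWMat, Matrix.det_succ_row_zero]
  simp [Fin.sum_univ_succ, Matrix.det_fin_three]
  ring

/-- `Φ♯` is differentiable where `g > 0`, with derivative `Φ♯'`. [calculus] -/
theorem hasFDerivAt_phiW (z : Fin 4 → ℝ) (hz : 0 < gW ρ z) : HasFDerivAt (phiW ρ) (phiW' ρ z) z := by
  have hs0 : sW ρ z ≠ 0 := (sW_pos hz).ne'
  have hπ0 : HasFDerivAt (fun y : Fin 4 → ℝ => y 0)
      (ContinuousLinearMap.proj (R := ℝ) (φ := fun _ : Fin 4 => ℝ) 0) z := hasFDerivAt_apply 0 z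
  have hπ1 : HasFDerivAt (fun y : Fin 4 → ℝ => y 1)
      (ContinuousLinearMap.proj (R := ℝ) (φ := fun _ : Fin 4 => ℝ) 1) z := hasFDerivAt_apply 1 z
  have hA1 : HasDerivAt (fun t : ℝ => (1 + t) ^ 2) (2 * (1 + z 0)) (z 0) := by
    simpa using HasDerivAt.comp_const_add 1 (z 0) (hasDerivAt_pow 2 (1 + z 0))
  have hA : HasFDerivAt (fun y : Fin 4 → ℝ => (1 + y 0) ^ 2)
      ((2 * (1 + z 0)) • ContinuousLinearMap.proj (R := ℝ) (φ := fun _ : Fin 4 => ℝ) 0) z :=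
    HasDerivAt.comp_hasFDerivAt (h₂ := fun t : ℝ => (1 + t) ^ 2) z hA1 hπ0
  have hB0 : HasDerivAt (fun t : ℝ => t ^ 2) (2 * z 1) (z 1) := by
    simpa using hasDerivAt_pow 2 (z 1)
  have hB1 : HasDerivAt (fun t : ℝ => 4 * t ^ 2) (4 * (2 * z 1)) (z 1) := hB0.const_mul 4
  have hB : HasFDerivAt (fun y : Fin 4 → ℝ => 4 * y 1 ^ 2)
      ((4 * (2 * z 1)) • ContinuousLinearMap.proj (R := ℝ) (φ := fun _ : Fin 4 => ℝ) 1) z :=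
    HasDerivAt.comp_hasFDerivAt (h₂ := fun t : ℝ => 4 * t ^ 2) z hB1 hπ1
  have hg : HasFDerivAt (gW ρ)
      (0 - (2 * (1 + z 0)) • ContinuousLinearMap.proj (R := ℝ) (φ := fun _ : Fin 4 => ℝ) 0 -
        (4 * (2 * z 1)) • ContinuousLinearMap.proj (R := ℝ) (φ := fun _ : Fin 4 => ℝ) 1) z :=
    ((hasFDerivAt_const (𝕜 := ℝ) (ρ : ℝ) z).sub hA).sub hB
  have hs : HasFDerivAt (sW ρ) ((1 / (2 * √(gW ρ z))) •
      (0 - (2 * (1 + z 0)) • ContinuousLinearMap.proj (R := ℝ) (φ := fun _ : Fin 4 => ℝ) 0 -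
        (4 * (2 * z 1)) • ContinuousLinearMap.proj (R := ℝ) (φ := fun _ : Fin 4 => ℝ) 1)) z :=
    HasDerivAt.comp_hasFDerivAt (h₂ := Real.sqrt) z (Real.hasDerivAt_sqrt hz.ne') hg
  have hroot : √(gW ρ z) = sW ρ z := rfl
  rw [hroot] at hs
  have h0 : HasFDerivAt (fun y : Fin 4 → ℝ => phiW ρ y 0)
      ((ContinuousLinearMap.proj 0).comp (phiW' ρ z)) z := by
    have hf : (fun y : Fin 4 → ℝ => phiW ρ y 0) = fun y => 1 + y 0 := funext phiW_zero
    rw [hf]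
    refine (hπ0.const_add 1).congr_fderiv (ContinuousLinearMap.ext fun v => ?_)
    simp [phiW'_apply, phiWMat, Fin.sum_univ_four]
  have h1 : HasFDerivAt (fun y : Fin 4 → ℝ => phiW ρ y 1)
      ((ContinuousLinearMap.proj 1).comp (phiW' ρ z)) z := by
    have hf : (fun y : Fin 4 → ℝ => phiW ρ y 1) = fun y => 2 * y 1 := funext phiW_one
    rw [hf]
    refine (hπ1.const_mul 2).congr_fderiv (ContinuousLinearMap.ext fun v => ?_)
    simp [phiW'_apply, phiWMat, Fin.sum_univ_four]
  have h2 : HasFDerivAt (fun y : Fin 4 → ℝ => phiW ρ y 2)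
      ((ContinuousLinearMap.proj 2).comp (phiW' ρ z)) z := by
    have hf : (fun y : Fin 4 → ℝ => phiW ρ y 2) = fun y => sW ρ y * y 2 := funext phiW_two
    rw [hf]
    refine (hs.mul (hasFDerivAt_apply 2 z)).congr_fderiv (ContinuousLinearMap.ext fun v => ?_)
    simp [phiW'_apply, phiWMat, Fin.sum_univ_four]
    field_simp
    ring
  have h3 : HasFDerivAt (fun y : Fin 4 → ℝ => phiW ρ y 3)
      ((ContinuousLinearMap.proj 3).comp (phiW' ρ z)) z := by
    have hf : (fun y : Fin 4 → ℝ => phiW ρ y 3) = fun y => sW ρ y * y 3 := funext phiW_three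
    rw [hf]
    refine (hs.mul (hasFDerivAt_apply 3 z)).congr_fderiv (ContinuousLinearMap.ext fun v => ?_)
    simp [phiW'_apply, phiWMat, Fin.sum_univ_four]
    field_simp
    ring
  refine hasFDerivAt_pi'' fun a => ?_
  fin_cases a
  · exact h0
  · exact h1
  · exact h2
  · exact h3

/-- `Φ♯` is injective where `g > 0`. [calculus] -/
theorem injOn_phiW : InjOn (phiW ρ) {z | 0 < gW ρ z} := by
  intro x hx y _ hxy
  have e0 : 1 + x 0 = 1 + y 0 := by simpa using congrFun hxy 0
  have e1 : 2 * x 1 = 2 * y 1 := by simpa using congrFun hxy 1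
  have e2 : sW ρ x * x 2 = sW ρ y * y 2 := by simpa using congrFun hxy 2
  have e3 : sW ρ x * x 3 = sW ρ y * y 3 := by simpa using congrFun hxy 3
  have h0 : x 0 = y 0 := by linarith
  have h1 : x 1 = y 1 := by linarith
  have hs : sW ρ x = sW ρ y := by simp only [sW, gW, h0, h1]
  have hs0 : sW ρ x ≠ 0 := (sW_pos hx).ne'
  rw [← hs] at e2 e3
  funext a
  fin_cases a
  · exact h0
  · exact h1
  · exact mul_left_cancel₀ hs0 e2
  · exact mul_left_cancel₀ hs0 e3

/-- `Φ♯` is a `ℚ`-semialgebraic map on every `ℚ`-semialgebraic set. [BCR1998 §2.2] -/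
theorem isSemialgebraicMapOn_phiW {S : Set (Fin 4 → ℝ)} (hS : IsSemialgebraic ℚ S) :
    IsSemialgebraicMapOn ℚ S (phiW ρ) := by
  have hsW : IsSemialgebraicFunOn ℚ S (sW ρ) :=
    (IsSemialgebraicFunOn.sqrt_holds (isSemialgebraicFunOn_aeval hS
      (C ρ - (1 + X 0) ^ 2 - 4 * X 1 ^ 2 : MvPolynomial (Fin 4) ℚ))).congr fun z _ => by
        simp only [sW, gW, map_sub, map_add, map_mul, map_pow, map_one, MvPolynomial.aeval_X,
          MvPolynomial.aeval_C, eq_ratCast, map_ofNat]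
  refine IsSemialgebraicMapOn.of_forall hS fun j => ?_
  fin_cases j
  · exact (isSemialgebraicFunOn_aeval hS (1 + X 0 : MvPolynomial (Fin 4) ℚ)).congr fun z _ => by simp
  · exact (isSemialgebraicFunOn_aeval hS (2 * X 1 : MvPolynomial (Fin 4) ℚ)).congr fun z _ => by simp
  · exact (hsW.mul_holds (isSemialgebraicFunOn_apply hS 2)).congr fun z _ => by simp
  · exact (hsW.mul_holds (isSemialgebraicFunOn_apply hS 3)).congr fun z _ => by simp

/-- **`Φ♯` maps the source onto the cap `K_0(ρ)`** (inverse: `z = (x₀ − 1, x₁/2, x₂/s, x₃/s)`,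
`s = √(ρ − x₀² − x₁²)`), every `ρ ≤ 4`. [calculus] -/
theorem image_phiW (q : ℚ) (h4 : ρ ≤ 4) : phiW ρ '' (srcRepH ρ q h4).domain = capSet ρ 0 := by
  ext x
  simp only [mem_image, mem_capSet]
  constructor
  · rintro ⟨z, hz, rfl⟩
    rw [mem_srcH_iff] at hz
    obtain ⟨⟨h0, h1, hr⟩, ⟨⟨h2a, h2b⟩, ⟨h3a, h3b⟩⟩, hd⟩ := hz
    have hg : 0 < gW ρ z := by rw [gW]; linarith
    have hs := sW_pos hg
    have hsq := sW_sq hg.le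
    refine ⟨fun j => ?_, by simp; linarith, ?_⟩
    · fin_cases j
      · simp; linarith
      · simp; linarith
      · simpa using mul_pos hs h2a
      · simpa using mul_pos hs h3a
    · rw [nsq, phiW_zero, phiW_one, phiW_two, phiW_three]
      rw [gW] at hsq
      nlinarith [mul_pos hs h2a, mul_pos hs h3a]
  · rintro ⟨hpos, hx0, hn⟩
    rw [nsq] at hn
    have h1 := hpos 1; have hx2 := hpos 2; have hx3 := hpos 3
    have hg : 0 < (ρ : ℝ) - x 0 ^ 2 - x 1 ^ 2 := by nlinarith
    set s : ℝ := √((ρ : ℝ) - x 0 ^ 2 - x 1 ^ 2) with hs_def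
    have hs : 0 < s := Real.sqrt_pos.2 hg
    have hsq : s ^ 2 = (ρ : ℝ) - x 0 ^ 2 - x 1 ^ 2 := Real.sq_sqrt hg.le
    have hsW : ∀ z : Fin 4 → ℝ, z 0 = x 0 - 1 → z 1 = x 1 / 2 → sW ρ z = s := by
      intro z hz0 hz1
      rw [sW, gW, hz0, hz1, hs_def]
      ring_nf
    refine ⟨![x 0 - 1, x 1 / 2, x 2 / s, x 3 / s], ?_, ?_⟩
    · rw [mem_srcH_iff]
      simp only [Matrix.cons_val_zero, Matrix.cons_val_one, Matrix.cons_val]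
      have h2s : x 2 < s := by nlinarith
      have h3s : x 3 < s := by nlinarith
      refine ⟨⟨by linarith, by linarith, by nlinarith⟩, ⟨⟨div_pos hx2 hs, (div_lt_one hs).2 h2s⟩,
        ⟨div_pos hx3 hs, (div_lt_one hs).2 h3s⟩⟩, ?_⟩
      rw [div_pow, div_pow, ← add_div, div_lt_one (by positivity), hsq]
      linarith
    · have hsz : sW ρ ![x 0 - 1, x 1 / 2, x 2 / s, x 3 / s] = s := hsW _ rfl rfl
      funext a
      fin_cases a
      · simp
      · simp only [Fin.reduceFinMk, phiW_one, Matrix.cons_val_one, Matrix.cons_val_zero]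
        ring
      · simp only [Fin.reduceFinMk, phiW_two, Matrix.cons_val, hsz]
        field_simp
      · simp only [Fin.reduceFinMk, phiW_three, Matrix.cons_val, hsz]
        field_simp

/-! #### Move (2): `[tRepH × quarter disc] − [K_0(ρ), q]` is a change of variables along `Φ♯` -/

/-- **Move (2), the wide cap chart:** `[tRepH ρ q × unit quarter disc] − [K_0(ρ), q] ∈ KZ.relations`
(`|det Φ♯'| = 2s² = 2(ρ − (1+y)² − 4y₁²)`, matching the source weight `8q·g♯`), every `ρ ≤ 4`.
[KontsevichZagier2001 §1.2 rule (2)] -/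
theorem of_srcRepH_sub_of_capRepW_mem_relations (q : ℚ) (h4 : ρ ≤ 4) :
    KZ.of (srcRepH ρ q h4) - KZ.of (capRepW ρ q h4 0) ∈ KZ.relations := by
  have hgdom : ∀ z ∈ (srcRepH ρ q h4).domain, 0 < gW ρ z := fun z hz => by
    rw [mem_srcH_iff] at hz
    rw [gW]; linarith [hz.1.2.2]
  refine KZ.changeOfVariablesRel_subset_relations
    ⟨2 + 2, srcRepH ρ q h4, capRepW ρ q h4 0, phiW ρ, phiW' ρ,
      isSemialgebraicMapOn_phiW (srcRepH ρ q h4).isSemialgebraic_domain,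
      fun z hz => (hasFDerivAt_phiW z (hgdom z hz)).hasFDerivWithinAt,
      injOn_phiW.mono hgdom, ?_, fun z hz => ?_, rfl⟩
  · exact (capRepW_domain q h4 0).trans (image_phiW q h4).symm
  · rw [srcRepH_integrand, capRepW_integrand, phiW'_det,
      abs_of_nonneg (mul_nonneg zero_le_two (sq_nonneg _)), sW_sq (hgdom z hz).le, gW]

end Summit.KontsevichZagierPeriods.RootDecompWalshStrata.CutBall4

end
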